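import Summits.PneNP.PneNP.Theorems.SzkEntropyPeaThreeNotInPSocketPEDAssembly
import Summits.PneNP.PneNP.Theorems.SzkEntropyPeaThreeNotInPSocketPEDGap
import HarnessLib

/-!
# Route SzkEntropy, crux `PeaThreeNotInP` (stmt-PneNP-10776), line `SketchIdeator3`, socket rider:
# the weak-gap entropy-difference socket `PEDBPGap num den ≤ₚ PED 3`

A client of the entropy-difference socket usually certifies only a CONSTANT gap: `H(q) ≤ H(p)` on one
side, `H(p) + ρ ≤ H(q)` on the other (`ρ = num/den`; e.g. `ρ = 1/9` for cube-smoothed lattice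
cosets).  Amplifying at the level of the encoded sparse maps (`T = 2·den` direct-product copies and
one free bit — Dvir–Gutfreund–Rothblum–Vadhan §3 p. 6, via the TI line's `powMap`) gives

* `rawPED_toPEDGap` (bridge), `PEDBPGap_polyTimeReducible_PED_three : PEDBPGap num den ≤ₚ PED 3`
  (`0 < num`, `0 < den`; stubs `stub_toPEDGap_mem`, `stub_toPEDGapRawFP stub_encodeBDDsRawFP`);
* **socket**: `peaThreeNotInP_of_PEDBPGap_not_mem : PEDBPGap num den ∉ PromiseP → PeaThreeNotInP`,
  `not_peaThreeMemBPP_of_PEDBPGap : PEDBPGap num den ∉ PromiseBPP' → ¬ PeaThreeMemBPP`.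

Sources: Z. Dvir, D. Gutfreund, G. N. Rothblum, S. Vadhan, ECCC TR10-160 (2010), §3 p. 6, Thm 4.6.
-/

namespace Summit.PneNP.PneNP.Cruxes.PeaThreeNotInP.SocketBP

set_option linter.dupNamespace false -- `Summit.PneNP.PneNP.…`: summit = sub-problem name (D-0017)

open _root_.Computability Finset
open Literature.InformationTheory.Entropy
open Literature.Computability.Complexity Literature.Computability.Complexity.RandPoly
open Literature.Computability.Cryptography (toInput fnList freshBDDs encodeBDDsMap encodeBDDs_fst_eq)
open CodeFP (natE pairE rawE listE)
open Summit.PneNP.PneNP.Theses.SzkEntropy (PeaThreeNotInP PeaThreeMemBPP)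
open Summit.PneNP.PneNP.Theorems (szkEntropy_peaThreeNotInP_iff szkEntropy_peaThreeMemBPP_iff)
open Summit.PneNP.PneNP.Cruxes.PeaThreeNotInP.TensorIsoLine (pedE rawPED encode_eq_pedE natOf_prod
  natOf_powMap powMap powN shiftN stub_pedCookPea)

/-- **The untyped data of `toPEDGap` is `toPEDGapRaw`.** [cite: DvirGutfreundRothblumVadhan2010, §3 p.6] -/
theorem rawPED_toPEDGap (T : ℕ) (I : PEDBPInst) : rawPED (toPEDGap T I) = toPEDGapRaw T I := by
  have hN : ∀ (n : ℕ) (Bs : List RawBP), (encodeBDDsRaw n n Bs).1 = n + freshBDDs (compileAll n Bs) :=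
    fun n Bs => by rw [encodeBDDsRaw_eq]; exact encodeBDDs_fst_eq _
  have hP : ∀ (n : ℕ) (Bs : List RawBP),
      (encodeBDDsRaw n n Bs).2 = natOf (encodeBDDsMap n (compileAll n Bs)) :=
    fun n Bs => by rw [encodeBDDsRaw_eq]; exact (natOf_toFinMap _ _ _).symm
  unfold toPEDGapRaw rawPED toPEDGap prodRaw
  simp only [hN, hP, Nat.add_sub_cancel_left, natOf_prod, natOf_powMap, natOf_idMap]
  rfl

/-- **`PEDBPGap num den ≤ₚ PED 3`**: a constant entropy-difference gap `num/den > 0` between two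
branching-program samplers compiles to `PED_{F₂,3}`. [cite: DvirGutfreundRothblumVadhan2010, §3 p.6] -/
theorem PEDBPGap_polyTimeReducible_PED_three {num den : ℕ} (hnum : 0 < num) (hden : 0 < den) :
    (PEDBPGap num den).PolyTimeReducible (PED 3) := by
  obtain ⟨F, hF, hFr⟩ := stub_toPEDGapRawFP (2 * den) stub_encodeBDDsRawFP
  have hred : ∀ I : PEDBPInst,
      F (PEDBPInst.encoding.encode I) = PEDInst.encoding.encode (toPEDGap (2 * den) I) := by
    intro I
    rw [encode_eq_pedbpE, hFr, encode_eq_pedE, rawPED_toPEDGap]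
  refine ⟨F, hF, fun w hw => ?_, fun w hw => ?_⟩
  · have hw' := hw
    obtain ⟨I, -, rfl⟩ : ∃ I, I ∈ _ ∧ PEDBPInst.encoding.encode I = w := hw
    rw [hred]
    exact (stub_toPEDGap_mem num den hnum hden).1 I hw'
  · have hw' := hw
    obtain ⟨I, -, rfl⟩ : ∃ I, I ∈ _ ∧ PEDBPInst.encoding.encode I = w := hw
    rw [hred]
    exact (stub_toPEDGap_mem num den hnum hden).2 I hw'

/-- **Weak-gap entropy-difference socket**: hardness of `PEDBPGap num den` (any `0 < num`, `0 < den`)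
gives the crux. [cite: DvirGutfreundRothblumVadhan2010, Thm 4.6] -/
theorem peaThreeNotInP_of_PEDBPGap_not_mem {num den : ℕ} (hnum : 0 < num) (hden : 0 < den)
    (h : PEDBPGap num den ∉ PromiseP) : PeaThreeNotInP := by
  rw [szkEntropy_peaThreeNotInP_iff]
  intro h3
  exact h (PromiseProblem.mem_PromiseP_of_polyTimeReducible_holds
    (PEDBPGap_polyTimeReducible_PED_three hnum hden)
    (PromiseProblem.mem_PromiseP_of_cookReducible_holds _ _ (stub_pedCookPea 3) h3))

/-- **Randomised form** of the weak-gap socket. [cite: DvirGutfreundRothblumVadhan2010, Thm 4.6] -/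
theorem not_peaThreeMemBPP_of_PEDBPGap {num den : ℕ} (hnum : 0 < num) (hden : 0 < den)
    (h : PEDBPGap num den ∉ PromiseBPP') : ¬ PeaThreeMemBPP := by
  rw [szkEntropy_peaThreeMemBPP_iff]
  intro h3
  exact h (PromiseProblem.mem_PromiseBPP'_of_polyTimeReducible_holds'
    (PEDBPGap_polyTimeReducible_PED_three hnum hden)
    (PromiseProblem.mem_PromiseBPP'_of_cookReducible_holds _ _ (stub_pedCookPea 3) h3))

end Summit.PneNP.PneNP.Cruxes.PeaThreeNotInP.SocketBP
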